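import Literature.MathematicalPhysics.QuantumFieldTheory.Balaban1983to89.B9Eq349ConjugatedGreenLetters

/-!
# `Balaban1983to89.B9Eq326ConjugatedLocalLetters` — T. Bałaban, *Propagators for lattice gauge theories in a background field*, Commun. Math. Phys. **99**
# (1985) 389–434 [Balaban1985BackgroundPropagators] (3.26) p. 395, (3.10) p. 392, (3.49) p. 399, Thm 3.11 p. 416 with [Balaban1985Variational] (134)–(136)
# p. 298: **PERTURBED COERCIVITY AND THE CONJUGATED-INVERSE BOUND FOR AN OPERATOR OF THE SHAPE OF THE LOCAL PART `A₀ = D*D + DD* + Δ′ + aQ*Q` —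
# three squares `B₁†B₁ + B₂†B₂ + aQ†Q` plus a bounded symmetric-part remainder `K`**: if `γ‖f‖² ≤ re⟪f, Hf⟫`, `re⟪f, Kf⟫ ≥ −p_K‖f‖²`, and the
# conjugated letters are `β`-close (`‖B_{i,κ} − B_i‖, ‖B′_{i,κ} − B_i†‖, ‖Q_κ − Q‖, ‖Q′_κ − Q†‖ ≤ β`, `‖K_κ − K‖ ≤ β_K`) on the window
# `p_K∕2 + 3(2+a)β² + β_K ≤ γ∕4`, then `(γ∕4)‖f‖² ≤ re⟪f, H_κf⟫` and any right inverse `G_κ` of `H_κ` obeys `‖G_κ‖ ≤ 4∕γ` — abstract finite-dimensional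
# `𝕜`-Hilbert letters, the twin of `B9Eq349ConjugatedGreenLetters` (`H = D′D + aQ′Q`, road B8″) for the NE9 owner's plan v11 stone (D0-b)

statement-level skeleton of published theorems with citation tags; proofs where landed; nothing here is a claim about the Yang–Mills mass gap

CITATION HEADER (lean-in-tree rule).  Audit cell `pub-balaban`, sub-cell `t4`, BINDER row NE9; filed by the NE9 BINDER-row OWNER lineage
`b2b-balaban-t4-ne9-p1` (gen 92).  Imports `B9Eq349ConjugatedGreenLetters` (ne9-leaf-01∕-06 road B8″: `re_inner_perturbed`, the second-order perturbation
bound of a conjugated square) only; Mathlib otherwise.  Sources READ first-hand (`paper:balaban1985-cmp99-background-propagators`, journal page = PDF page +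
388): p. 395 (3.26) *«Δ_a(U) = Δ(U) + D_UR(U)D*_U + Q*(U)aQ(U)»*, p. 392 (3.10) *«⟨A, ΔA⟩ = ⟨A, D*DA⟩ + ⟨A, Δ′A⟩»*, p. 416 Thm 3.11 *«the operators … Δ_a,
G are positive, uniformly bounded from below … the kernels … decay exponentially»*, p. 399 (3.49); [Balaban1985Variational] p. 298 (134)–(135) (the split
`Δ + DRD* = (D*D + DD*) + (Δ′ − DPD*)`, `D*D + DD* = Δ_U − η⁻²𝒦`).  Print's decay proof is the random walk of Sect. C; the conjugation is the ROUTE's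
Combes–Thomas substitute (`t4/ROUTES-NE9.md` §L1.2 road B8″); nothing of print's rate is asserted.

WHAT IS PROVED (sorry-free; proof lane — no `def`; [folklore] Hilbert-space algebra).  Spaces `E` (bond fields), `P` (plaquette fields), `S` (site fields),
`F` (block fields); `B₁ : E → P` (the curl), `B₂ : E → S` (the divergence `D*`, whose adjoint is `D`), `Q : E → F`, `K : E → E` (the zeroth-order remainder
`Δ′`, or `Δ′ − η⁻²𝒦` — any operator with a real-part lower bound); `H f = B₁†(B₁f) + B₂†(B₂f) + Kf + a•Q†(Qf)`.
* §1 **`re_inner_H_eq`** — `re⟪f, Hf⟫ = ‖B₁f‖² + ‖B₂f‖² + re⟪f, Kf⟫ + a‖Qf‖²`.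
* §2 the conjugated family `H_κ f = B′_{1,κ}(B_{1,κ}f) + B′_{2,κ}(B_{2,κ}f) + K_κf + a•Q′_κ(Q_κf)`: **`re_inner_Kk_ge`** (`re⟪f, K_κf⟫ ≥ re⟪f, Kf⟫ − β_K‖f‖²`),
  **`coercive_k`** (`(γ∕4)‖f‖² ≤ re⟪f, H_κf⟫` on the window), **`norm_Gk_le`** (`‖G_κ‖ ≤ 4∕γ` for `H_κG_κ = 1`), and the unconjugated reading
  **`norm_G_le`** (`β = β_K = 0`: `‖H⁻¹‖ ≤ 4∕γ` whenever `p_K ≤ γ∕2`).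
HONEST SCOPE.  Abstract letters; the instance at the chain's `A₀` (with `B9Eq3101ConjugationLettersCurl` ∕ `…Chain` supplying the `β`'s, `γ` from Thm 3.11 via
`B9Eq326WoodburySchur.local_coercive_of_coercive`, `p_K`, `β_K` displayed) is the next brick (D0-c); nothing of [B9] Thm 3.1∕3.3∕3.11 asserted; «NE9 ⇐ the
named binders»; NE9 NOT PRINTED ∕ NOT PROVED; row WALLED ON A MODEL (O-NE9-1; #5 UNRULED); spine PROVED 0∕9; rung (B)+1 on a finite T⁴ — NOT infinite
volume, NOT mass gap, NOT BetaPertH, NOT Clay.  HONEST DEPENDENCY: continuum YM on T⁴ ⇐ BetaPertH ∧ nine spine estimates (0/9 proved); BetaPertH ⇐ (D1) ∧ (D4)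
∧ CAP+tail.  NEW file; nothing modified.  Net new unproved facts: 0.
-/

noncomputable section

open scoped InnerProductSpace ComplexConjugate

namespace Literature.MathematicalPhysics.QuantumFieldTheory.Balaban1983to89.B9Eq326ConjugatedLocalLetters

open B9Eq349ConjugatedGreenLetters (re_inner_perturbed)

variable {𝕜 : Type*} [RCLike 𝕜]
  {E : Type*} [NormedAddCommGroup E] [InnerProductSpace 𝕜 E] [FiniteDimensional 𝕜 E]
  {P : Type*} [NormedAddCommGroup P] [InnerProductSpace 𝕜 P] [FiniteDimensional 𝕜 P]
  {S : Type*} [NormedAddCommGroup S] [InnerProductSpace 𝕜 S] [FiniteDimensional 𝕜 S]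
  {F : Type*} [NormedAddCommGroup F] [InnerProductSpace 𝕜 F] [FiniteDimensional 𝕜 F]

omit [FiniteDimensional 𝕜 E] in
/-- `re⟪x, y⟫ ≤ ‖x‖‖y‖`. [folklore] [cite: Balaban1985BackgroundPropagators, (3.11) p.392] -/
private theorem re_inner_le_mul_norm' (x y : E) : RCLike.re ⟪x, y⟫_𝕜 ≤ ‖x‖ * ‖y‖ :=
  (RCLike.re_le_norm _).trans (norm_inner_le_norm x y)

omit [FiniteDimensional 𝕜 E] in
/-- `−‖x‖‖y‖ ≤ re⟪x, y⟫`. [folklore] [cite: Balaban1985BackgroundPropagators, (3.11) p.392] -/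
private theorem neg_mul_norm_le_re_inner' (x y : E) : -(‖x‖ * ‖y‖) ≤ RCLike.re ⟪x, y⟫_𝕜 := by
  have h1 := (abs_le.1 (RCLike.abs_re_le_norm ⟪x, y⟫_𝕜)).1
  have h2 := norm_inner_le_norm (𝕜 := 𝕜) x y
  linarith

/-! ## §1 The structure `H = B₁†B₁ + B₂†B₂ + K + aQ†Q` -/

section Structure

variable (B₁ : E →ₗ[𝕜] P) (B₂ : E →ₗ[𝕜] S) (Q : E →ₗ[𝕜] F) (K H : E →ₗ[𝕜] E) (a : ℝ)
  (hH : ∀ f, H f = LinearMap.adjoint B₁ (B₁ f) + LinearMap.adjoint B₂ (B₂ f) + K f + ((a : ℝ) : 𝕜) • LinearMap.adjoint Q (Q f))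

include hH in
/-- **`re⟪f, Hf⟫ = ‖B₁f‖² + ‖B₂f‖² + re⟪f, Kf⟫ + a‖Qf‖²`** for `H = B₁†B₁ + B₂†B₂ + K + aQ†Q` — the quadratic form of the local part
`A₀ = D*D + DD* + Δ′ + aQ*Q` ((3.26) with (3.10): `⟨A, D*DA⟩ = ‖DA‖²`, `⟨A, DD*A⟩ = ‖D*A‖²`). [folklore]
[cite: Balaban1985BackgroundPropagators, (3.26) p.395, (3.10) p.392] -/
theorem re_inner_H_eq (f : E) :
    RCLike.re ⟪f, H f⟫_𝕜 = ‖B₁ f‖ ^ 2 + ‖B₂ f‖ ^ 2 + RCLike.re ⟪f, K f⟫_𝕜 + a * ‖Q f‖ ^ 2 := by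
  rw [hH, inner_add_right, inner_add_right, inner_add_right, map_add, map_add, map_add, LinearMap.adjoint_inner_right,
    LinearMap.adjoint_inner_right, inner_smul_real_right, RCLike.smul_re, LinearMap.adjoint_inner_right, inner_self_eq_norm_sq (𝕜 := 𝕜),
    inner_self_eq_norm_sq (𝕜 := 𝕜), inner_self_eq_norm_sq (𝕜 := 𝕜)]

end Structure

/-! ## §2 The conjugated family: perturbed coercivity and `‖G_κ‖ ≤ 4∕γ` -/

section Family

variable (B₁ : E →ₗ[𝕜] P) (B₂ : E →ₗ[𝕜] S) (Q : E →ₗ[𝕜] F) (K H : E →ₗ[𝕜] E) (a γ β βK pK : ℝ)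
  (B₁k : E →ₗ[𝕜] P) (B₁k' : P →ₗ[𝕜] E) (B₂k : E →ₗ[𝕜] S) (B₂k' : S →ₗ[𝕜] E) (Qk : E →ₗ[𝕜] F) (Qk' : F →ₗ[𝕜] E) (Kk Hk Gk : E →ₗ[𝕜] E)
  (ha : 0 ≤ a) (hγ : 0 < γ) (hβ : 0 ≤ β) (hβK : 0 ≤ βK)
  (hH : ∀ f, H f = LinearMap.adjoint B₁ (B₁ f) + LinearMap.adjoint B₂ (B₂ f) + K f + ((a : ℝ) : 𝕜) • LinearMap.adjoint Q (Q f))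
  (coercive : ∀ f, γ * ‖f‖ ^ 2 ≤ RCLike.re ⟪f, H f⟫_𝕜)
  (hKre : ∀ f, -(pK * ‖f‖ ^ 2) ≤ RCLike.re ⟪f, K f⟫_𝕜)
  (dB₁ : ∀ f, ‖B₁k f - B₁ f‖ ≤ β * ‖f‖) (dB₁' : ∀ p, ‖B₁k' p - LinearMap.adjoint B₁ p‖ ≤ β * ‖p‖)
  (dB₂ : ∀ f, ‖B₂k f - B₂ f‖ ≤ β * ‖f‖) (dB₂' : ∀ s, ‖B₂k' s - LinearMap.adjoint B₂ s‖ ≤ β * ‖s‖)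
  (dQ : ∀ f, ‖Qk f - Q f‖ ≤ β * ‖f‖) (dQ' : ∀ g, ‖Qk' g - LinearMap.adjoint Q g‖ ≤ β * ‖g‖)
  (dK : ∀ f, ‖Kk f - K f‖ ≤ βK * ‖f‖)
  (small : pK / 2 + 3 * (2 + a) * β ^ 2 + βK ≤ γ / 4)
  (hHk : ∀ f, Hk f = B₁k' (B₁k f) + B₂k' (B₂k f) + Kk f + ((a : ℝ) : 𝕜) • Qk' (Qk f)) (hHkGk : ∀ v, Hk (Gk v) = v)

omit [FiniteDimensional 𝕜 E] in
include dK in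
/-- **The remainder keeps its real-part lower bound up to `β_K`**: `re⟪f, K_κf⟫ ≥ re⟪f, Kf⟫ − β_K‖f‖²`. [folklore]
[cite: Balaban1985BackgroundPropagators, (3.10) p.392, (3.49) p.399; Balaban1985Variational, (135)–(136) p.298] -/
theorem re_inner_Kk_ge (f : E) : RCLike.re ⟪f, K f⟫_𝕜 - βK * ‖f‖ ^ 2 ≤ RCLike.re ⟪f, Kk f⟫_𝕜 := by
  have e : ⟪f, Kk f⟫_𝕜 = ⟪f, K f⟫_𝕜 + ⟪f, Kk f - K f⟫_𝕜 := by rw [← inner_add_right, add_sub_cancel]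
  rw [e, map_add]
  have h1 := neg_mul_norm_le_re_inner' (𝕜 := 𝕜) f (Kk f - K f)
  have h2 : ‖f‖ * ‖Kk f - K f‖ ≤ ‖f‖ * (βK * ‖f‖) := mul_le_mul_of_nonneg_left (dK f) (norm_nonneg _)
  nlinarith [h1, h2]

include ha hβ hH coercive hKre dB₁ dB₁' dB₂ dB₂' dQ dQ' dK small hHk in
/-- **PERTURBED COERCIVITY** of `H_κ = B′_{1,κ}B_{1,κ} + B′_{2,κ}B_{2,κ} + K_κ + aQ′_κQ_κ`: on the window `p_K∕2 + 3(2+a)β² + β_K ≤ γ∕4`,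
`(γ∕4)‖f‖² ≤ re⟪f, H_κf⟫` — each conjugated square keeps half of itself up to `3β²` (`re_inner_perturbed`), the three halves together are
`½(re⟪f,Hf⟫ − re⟪f,Kf⟫) ≥ ½γ‖f‖² − ½re⟪f,Kf⟫`, and `½re⟪f,Kf⟫ ≥ −½p_K‖f‖²`. [folklore]
[cite: Balaban1985BackgroundPropagators, (3.26) p.395, (3.49) p.399, Thm 3.11 p.416; Balaban1985Variational, (134)–(136) p.298] -/
theorem coercive_k (f : E) : γ / 4 * ‖f‖ ^ 2 ≤ RCLike.re ⟪f, Hk f⟫_𝕜 := by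
  have e : RCLike.re ⟪f, Hk f⟫_𝕜 = RCLike.re ⟪f, B₁k' (B₁k f)⟫_𝕜 + RCLike.re ⟪f, B₂k' (B₂k f)⟫_𝕜 + RCLike.re ⟪f, Kk f⟫_𝕜 +
      a * RCLike.re ⟪f, Qk' (Qk f)⟫_𝕜 := by
    rw [hHk, inner_add_right, inner_add_right, inner_add_right, map_add, map_add, map_add, inner_smul_real_right, RCLike.smul_re]
  have e0 := re_inner_H_eq B₁ B₂ Q K H a hH f
  have p1 := re_inner_perturbed B₁ B₁k B₁k' hβ dB₁ dB₁' f
  have p2 := re_inner_perturbed B₂ B₂k B₂k' hβ dB₂ dB₂' f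
  have pQ := mul_le_mul_of_nonneg_left (re_inner_perturbed Q Qk Qk' hβ dQ dQ' f) ha
  have pK' := re_inner_Kk_ge K βK Kk dK f
  have sm := mul_le_mul_of_nonneg_right small (sq_nonneg ‖f‖)
  have co := coercive f
  have hk := hKre f
  have hq : 0 ≤ a * ‖Q f‖ ^ 2 := by positivity
  nlinarith [e, e0, p1, p2, pQ, pK', sm, co, hk, hq]

include ha hγ hβ hH coercive hKre dB₁ dB₁' dB₂ dB₂' dQ dQ' dK small hHk hHkGk in
/-- **`‖G_κ‖ ≤ 4∕γ`** for any right inverse `G_κ` of the conjugated local part (`H_κG_κ = 1`): `(γ∕4)‖G_κv‖² ≤ re⟪G_κv, v⟫ ≤ ‖G_κv‖‖v‖`.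
[folklore] [cite: Balaban1985BackgroundPropagators, (3.26) p.395, (3.49) p.399, Thm 3.11 p.416] -/
theorem norm_Gk_le (v : E) : ‖Gk v‖ ≤ 4 / γ * ‖v‖ := by
  have h1 := coercive_k B₁ B₂ Q K H a γ β βK pK B₁k B₁k' B₂k B₂k' Qk Qk' Kk Hk ha hβ hH coercive hKre dB₁ dB₁' dB₂ dB₂' dQ dQ' dK small hHk
    (Gk v)
  rw [hHkGk] at h1
  have h2 := re_inner_le_mul_norm' (𝕜 := 𝕜) (Gk v) v
  by_cases hx : Gk v = 0
  · rw [hx, norm_zero]; positivity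
  · have hxpos : 0 < ‖Gk v‖ := norm_pos_iff.mpr hx
    rw [div_mul_eq_mul_div, le_div_iff₀ hγ]
    nlinarith [h1, h2, hxpos, norm_nonneg v]

end Family

/-! ## §2′ The unconjugated reading (`β = β_K = 0`) -/

section Base

variable (B₁ : E →ₗ[𝕜] P) (B₂ : E →ₗ[𝕜] S) (Q : E →ₗ[𝕜] F) (K H G : E →ₗ[𝕜] E) (a γ pK : ℝ)
  (ha : 0 ≤ a) (hγ : 0 < γ)
  (hH : ∀ f, H f = LinearMap.adjoint B₁ (B₁ f) + LinearMap.adjoint B₂ (B₂ f) + K f + ((a : ℝ) : 𝕜) • LinearMap.adjoint Q (Q f))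
  (coercive : ∀ f, γ * ‖f‖ ^ 2 ≤ RCLike.re ⟪f, H f⟫_𝕜) (hKre : ∀ f, -(pK * ‖f‖ ^ 2) ≤ RCLike.re ⟪f, K f⟫_𝕜) (small : pK / 2 ≤ γ / 4)
  (hHG : ∀ v, H (G v) = v)

include ha hγ hH coercive hKre small hHG in
/-- `‖H⁻¹‖ ≤ 4∕γ` for the unconjugated local part whenever `p_K ≤ γ∕2` (the `β = β_K = 0` reading of `norm_Gk_le`; the sharp `γ⁻¹` is
`B9Eq326WoodburySchur.norm_localInv_le`). [folklore] [cite: Balaban1985BackgroundPropagators, (3.26) p.395, Thm 3.11 p.416] -/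
theorem norm_G_le (v : E) : ‖G v‖ ≤ 4 / γ * ‖v‖ :=
  norm_Gk_le B₁ B₂ Q K H a γ 0 0 pK B₁ (LinearMap.adjoint B₁) B₂ (LinearMap.adjoint B₂) Q (LinearMap.adjoint Q) K H G ha hγ le_rfl hH coercive
    hKre (fun f => by simp) (fun p => by simp) (fun f => by simp) (fun s => by simp) (fun f => by simp) (fun g => by simp) (fun f => by simp)
    (by nlinarith) hH hHG v

end Base

end Literature.MathematicalPhysics.QuantumFieldTheory.Balaban1983to89.B9Eq326ConjugatedLocalLetters

end
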